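import Summits.BirchSwinnertonDyer.BirchSwinnertonDyer.Theorems.Rank2Observatory2DescFunctionals
import HarnessLib

/-!
# BirchSwinnertonDyer — rank ≥ 2 observatory: a kernel-decidable form of the standard admissibility test

HONEST FRAMING: per-curve certified theorems and census instruments; no claim on BSD in rank ≥ 2.

Generic addendum of the KERNEL-2DESC instrument (design `b2b-bsdr2-cert-3/KERNEL-2DESC.md` §4
A4/A6). The standard test `admStd` decides `IsSquare` on `ℤ` through Mathlib's instance, which
goes through `Nat.sqrt` (well-founded recursion) and does not reduce in the kernel, so the final
count `#{admissible} ≤ 2^s'` of `mordellWeilRank_le_of_coverSet` cannot be discharged by `decide`.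
`admStdK B` replaces the square test by a bounded search `∃ r ≤ B, r² = z`, which the kernel
evaluates; `admStdK_of_admStd` transfers soundness from `admStd_sound` whenever `|z| ≤ B²`
(`admStdK_of_admStd'`: uniformly in `(T, U)` from `∏|Nu|·∏|Ng| ≤ B²`).
Also: `aeval_poly_eq`, the explicit form of `aeval x (MonicCubic.poly A B C)` (symbolic in
`A, B, C`, so that numeral coefficients do not disturb `simp`).

Sorry-free; axioms `propext`, `Classical.choice`, `Quot.sound`. [folklore]
-/

-- single-conjunct summit: `Summit.BirchSwinnertonDyer.BirchSwinnertonDyer.…` repeats the name by design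
set_option linter.dupNamespace false

noncomputable section

open scoped Classical

open Literature.NumberTheory.NumberFields Polynomial

namespace Summit.BirchSwinnertonDyer.BirchSwinnertonDyer.Rank2Observatory.TwoDescCubic

variable {m s : ℕ}

/-- **Kernel-decidable standard test**: bounded square search (`r ≤ B`) on the product of the norms,
and the real-sign parity. [folklore] -/
def admStdK (B : ℕ) (Nu : Fin m → ℤ) (Ng : Fin s → ℤ) (su : Fin m → Bool) (sg : Fin s → Bool)
    (T : Finset (Fin m)) (U : Finset (Fin s)) : Bool :=
  decide (∃ r : Fin (B + 1), ((r : ℕ) : ℤ) ^ 2 = (∏ i ∈ T, Nu i) * ∏ j ∈ U, Ng j) &&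
    decide (Even ((T.filter fun i => su i = true).card + (U.filter fun j => sg j = true).card))

/-- A square `z` with `|z| ≤ B²` has a root `r ≤ B`. [folklore] -/
theorem exists_fin_sq_eq_of_isSquare {B : ℕ} {z : ℤ} (hz : IsSquare z) (hB : z.natAbs ≤ B ^ 2) :
    ∃ r : Fin (B + 1), ((r : ℕ) : ℤ) ^ 2 = z := by
  obtain ⟨r, hr⟩ := hz
  have hrB : r.natAbs ≤ B := by
    by_contra h
    push Not at h
    have h1 : B ^ 2 < r.natAbs ^ 2 := Nat.pow_lt_pow_left h (by norm_num)
    have h2 : z.natAbs = r.natAbs ^ 2 := by rw [hr, Int.natAbs_mul, sq]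
    omega
  refine ⟨⟨r.natAbs, Nat.lt_succ_of_le hrB⟩, ?_⟩
  simp only
  rw [Int.natAbs_sq, hr, sq]

/-- **Transfer of soundness**: `admStd = true` and `|z| ≤ B²` give `admStdK B = true`. [folklore] -/
theorem admStdK_of_admStd {B : ℕ} {Nu : Fin m → ℤ} {Ng : Fin s → ℤ} {su : Fin m → Bool}
    {sg : Fin s → Bool} {T : Finset (Fin m)} {U : Finset (Fin s)}
    (hB : ((∏ i ∈ T, Nu i) * ∏ j ∈ U, Ng j).natAbs ≤ B ^ 2)
    (h : admStd Nu Ng su sg T U = true) : admStdK B Nu Ng su sg T U = true := by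
  rw [admStd, Bool.and_eq_true, decide_eq_true_eq, decide_eq_true_eq] at h
  rw [admStdK, Bool.and_eq_true, decide_eq_true_eq, decide_eq_true_eq]
  exact ⟨exists_fin_sq_eq_of_isSquare h.1 hB, h.2⟩

/-- `|∏_{i ∈ T} f i| ≤ ∏_i |f i|` for non-zero integers. [folklore] -/
theorem natAbs_prod_le_prod_univ {ι : Type*} [Fintype ι] [DecidableEq ι] (f : ι → ℤ)
    (hf : ∀ i, f i ≠ 0) (T : Finset ι) : (∏ i ∈ T, f i).natAbs ≤ ∏ i, (f i).natAbs := by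
  have h : (∏ i ∈ T, f i).natAbs = ∏ i ∈ T, (f i).natAbs := by
    simpa only [Int.natAbsHom_apply] using map_prod Int.natAbsHom f T
  rw [h]
  exact Finset.prod_le_prod_of_subset_of_one_le' (Finset.subset_univ T)
    (fun i _ _ => Int.natAbs_pos.mpr (hf i))

/-- **Transfer of soundness, uniform bound**: `admStd = true` and `∏|Nu| · ∏|Ng| ≤ B²` give
`admStdK B = true` for every pair `(T, U)`. [folklore] -/
theorem admStdK_of_admStd' {B : ℕ} {Nu : Fin m → ℤ} {Ng : Fin s → ℤ} {su : Fin m → Bool}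
    {sg : Fin s → Bool} (hNu : ∀ i, Nu i ≠ 0) (hNg : ∀ j, Ng j ≠ 0)
    (hB : (∏ i, (Nu i).natAbs) * ∏ j, (Ng j).natAbs ≤ B ^ 2) {T : Finset (Fin m)}
    {U : Finset (Fin s)} (h : admStd Nu Ng su sg T U = true) : admStdK B Nu Ng su sg T U = true := by
  refine admStdK_of_admStd (le_trans ?_ hB) h
  rw [Int.natAbs_mul]
  exact Nat.mul_le_mul (natAbs_prod_le_prod_univ Nu hNu T) (natAbs_prod_le_prod_univ Ng hNg U)

/-- `admStdK B` admits the trivial pair (`r = 1`, needs `1 ≤ B`). [folklore] -/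
theorem admStdK_empty {B : ℕ} (hB : 1 ≤ B) (Nu : Fin m → ℤ) (Ng : Fin s → ℤ) (su : Fin m → Bool)
    (sg : Fin s → Bool) : admStdK B Nu Ng su sg ∅ ∅ = true := by
  rw [admStdK, Bool.and_eq_true, decide_eq_true_eq, decide_eq_true_eq]
  refine ⟨⟨⟨1, by omega⟩, by simp⟩, by simp⟩

/-- The explicit form of `aeval x f` for `f = X³ + AX² + BX + C` (symbolic coefficients).
[folklore] -/
theorem aeval_poly_eq {R : Type*} [CommRing R] (x : R) (A B C : ℤ) :
    aeval x (MonicCubic.poly A B C) = x ^ 3 + (A : R) * x ^ 2 + (B : R) * x + (C : R) := by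
  simp only [MonicCubic.poly, map_add, map_mul, map_pow, aeval_X, eq_intCast, map_intCast]

end Summit.BirchSwinnertonDyer.BirchSwinnertonDyer.Rank2Observatory.TwoDescCubic

end
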